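import Summits.BirchSwinnertonDyer.BirchSwinnertonDyer.Theses.SignedBaseChange
import Summits.BirchSwinnertonDyer.BirchSwinnertonDyer.Theorems.SignedBaseChangeAnticyclotomicEisensteinDivisibilityAwayDiscrepancyLocal
import Summits.BirchSwinnertonDyer.BirchSwinnertonDyer.Theorems.SignedBaseChangeAnticyclotomicEisensteinDivisibilityControlTorsionLocal
import Summits.BirchSwinnertonDyer.BirchSwinnertonDyer.Theorems.EisensteinPrimesUnramifiedLeAwayKer
import Literature.NumberTheory.EllipticCurves.BigRepModuleShapiroSelmerConditionsProofs
import Literature.NumberTheory.EllipticCurves.ZpExtensionUnramifiedProofs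
import Literature.NumberTheory.DiophantineGeometry.LocalReductionFiniteBadPlacesProofs
import Literature.NumberTheory.GaloisRepresentations.DecompositionGroupOfCompletion
import HarnessLib

/-!
# Stub (b₁) `stub_awayDiscrepancySS` of line `bdpline` (crux `AnticyclotomicEisensteinDivisibility`,
# stmt-BirchSwinnertonDyer-20727), PROVED: the one-variable away-from-`p` / archimedean discrepancy
# `datumStrictSelmer (ker κ₂) E[p^∞] p (bdpData v̄) ∅ ⧸ Sel_v̄(K_∞⁻, E[p^∞])` is killed by ONE integer

Lead seat bsd-line-sbc-p1 gen 3 (2026-08-28). The registered stub asks, for every character `x` of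
`H¹_{nr,v̄}(K̃_∞, E[p^∞])` vanishing on `res(Sel_v̄(K_∞⁻, E[p^∞]))`, for a NON-ZERO `g ∈ Λ = ℤ_p⟦T⟧`
killing `x` on the restrictions of the classes over `K_∞⁻` that are unramified away from `p` and strict
at `v̄` (`datumStrictSelmer … ∅`). We prove MORE, with no use of the Heegner hypothesis and no class
field theory beyond the tree's `ZpExtension.inertia_le_kerSubgroup_holds` (Washington Prop. 13.2):

* §1 `exists_nsmul_mem_selmerAc_of_mem_datumStrictSelmer` — for ANY elliptic `W` over a number field
  `K` with all infinite places complex, any prime `p`, any `ℤ_p`-extension `κ`, and any `𝔭 ∋ p`, there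
  is `t ≠ 0` with `t · datumStrictSelmer (ker κ) E[p^∞] p (bdpData 𝔭) ∅ ⊆ Sel_𝔭(K_∞, E[p^∞])`
  (Castella's group, `Σ = ∅`). Place by place over `K_∞ = K̄^{ker κ}`: at infinite places nothing
  (`decompInf_eq_bot_of_isComplex`); at `v ∣ p` the two strict conditions coincide
  (`selmerOver_empty_eq_strictSelmerGroupOver`); at `v ∤ p` NOT splitting completely (`D_v ⊄ ker κ`)
  unramified ⟹ locally trivial (`UnramifiedLeAwayKer.unramifiedKer_le_awayKer_of_not_decomp_le`,
  pro-`p′` residual quotient); at a GOOD `v ∤ p` splitting completely, unramified ⟹ locally trivial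
  (`mem_awayKer_of_mem_unramifiedKer_of_decomp_le`, Greenberg's Lemma 3.3); at the finitely many BAD
  `v ∤ p` (`finite_badPlaces_holds`) splitting completely, after multiplication by the local exponent
  `t_v` (`exists_nsmul_mem_awayKer_of_decomp_le`); `t = ∏ t_v`.
* §2 `stub_awayDiscrepancySS` — the registered signature (skeleton bdpline v15, b1a347aa59181dce),
  with `g = (t : Λ)` a CONSTANT: `(C (t : Λ) : Λ₂) • x = t • x`, and `t • res a = res (t • a)` with
  `t • a ∈ Sel_v̄(K_∞⁻, E[p^∞])`, on which `x` vanishes by hypothesis. Only the binders `K` imaginary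
  quadratic and `p ∈ v̄` are used (the telescope's other binders, (V) and `κ₁` cyclotomic included,
  are idle).

Castella 2018 §2.2 (eq:defs) computes this discrepancy as `⊕_{w ∤ p} ℋ^ur_w` with `ℋ^ur_w` finite;
this file is its kernel version over the tree's constructed carriers. No new definition, no named fact,
no `sorry`. BSD / the crux are not proved by this file.

References: F. Castella, Camb. J. Math. 6 (2018), Def. 2.2 and §2.2 (arXiv:1704.06608 pp. 5, 7);
R. Greenberg, LNM 1716 (1999), §3 Lemma 3.3 (p. 87); R. Greenberg, V. Vatsal, Invent. Math. 142
(2000), §2 p. 17; C. Skinner, E. Urban, Invent. Math. 195 (2014), Prop. 3.2.8; L. Washington,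
*Introduction to Cyclotomic Fields*, Prop. 13.2.
-/

-- D-0017: single-problem summit, the namespace repeats the problem name by design.
set_option linter.dupNamespace false
set_option autoImplicit false

noncomputable section

open scoped Classical

open NumberField IsDedekindDomain Field
open Literature.NumberTheory.EllipticCurves Literature.NumberTheory.EllipticCurves.GreenbergSelmer
  Literature.NumberTheory.EllipticCurves.GreenbergVatsal2000 Literature.NumberTheory.GaloisRepresentations
  IsDedekindDomain.HeightOneSpectrum

namespace Summit.BirchSwinnertonDyer.BirchSwinnertonDyer.Theorems.SignedBaseChangeAcDivAwayDiscrepancy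

open Summit.BirchSwinnertonDyer.BirchSwinnertonDyer.Theses.SignedBaseChange
  Literature.NumberTheory.EllipticCurves.Castella2018

/-! ## §1 One variable: `t · datumStrictSelmer ∅ ⊆ Sel_𝔭(K_∞, E[p^∞])` for a bounded integer `t ≠ 0` -/

section OneVariable

variable {K : Type} [Field K] [NumberField K] (W : WeierstrassCurve K) [W.IsElliptic]
  (p : ℕ) [Fact p.Prime] (κ : ZpExtension K p)

omit [NumberField K] [W.IsElliptic] [Fact p.Prime] in
/-- **Complex places impose nothing**: if `decompInf w = ⊥` then every class of `H¹(H, E[p^∞])` lies in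
`infKer H E[p^∞] w` (`H¹` of the trivial group vanishes). (Re-proved here to keep the import cone small;
same statement as x11b's `mem_infKer_of_decompInf_eq_bot`.) [cite: GreenbergLNM1716, §3 p. 87 (archimedean primes)] -/
theorem mem_infKer_of_decompInf_eq_bot' {H : Subgroup (absoluteGaloisGroup K)} (w : InfinitePlace K)
    (hw : decompInf w = ⊥) (c : W.subgroupH1 p H) : c ∈ infKer H (W.geomPrimaryTorsion p) w := by
  rw [infKer, AddMonoidHom.mem_ker]
  obtain ⟨ψ, hψ⟩ := oneCocycleClass_surjective _
    (resOfLe (W.geomPrimaryTorsion p) (inf_le_left : H ⊓ decompInf w ≤ H) c)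
  rw [← hψ]
  have h0 : ψ = 0 := by
    apply Subtype.ext
    refine ContinuousMap.ext fun x ↦ ?_
    have hx : x = 1 := by
      apply Subtype.ext
      have h : (x : absoluteGaloisGroup K) ∈ (⊥ : Subgroup (absoluteGaloisGroup K)) := by
        rw [← hw]; exact (Subgroup.mem_inf.mp x.2).2
      exact Subgroup.mem_bot.mp h
    rw [hx]
    exact contOneCocycles.apply_one ψ
  rw [h0, oneCocycleClass_zero]

/-- **The local comparison at every `v ∤ p` over `K_∞ = K̄^{ker κ}`, UNIFORMLY**: for an elliptic curve
`E` over a number field `K`, a prime `p` and a `ℤ_p`-extension `κ`, there is ONE integer `t ≠ 0` such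
that for every finite `v ∤ p` every class of `H¹(Gal(K̄/K_∞), E[p^∞])` unramified at the chosen place
above `v` becomes locally trivial there after multiplication by `t`. Cases: `D_v ⊄ ker κ` (finitely
decomposed): already trivial (pro-`p′` residual quotient; `ℤ_p`-extensions are unramified at `v`);
`D_v ≤ ker κ` and `v` good: already trivial (Greenberg's Lemma 3.3); `D_v ≤ ker κ` and `v` bad: after
`t_v`, and the bad places are finitely many (`t = ∏ t_v`). Castella's `⊕_{w∤p} ℋ^ur_w` has bounded
exponent. [cite: Castella2018, §2.2 (arXiv:1704.06608 p. 7)] [cite: GreenbergLNM1716, §3 Lemma 3.3 (p. 87)]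
[cite: GreenbergVatsal2000, §2 p. 17] [cite: Washington1997, Prop. 13.2] -/
theorem exists_nsmul_mem_awayKer_of_mem_unramifiedKer :
    ∃ t : ℕ, t ≠ 0 ∧ ∀ (v : HeightOneSpectrum (𝓞 K)), ((p : ℕ) : 𝓞 K) ∉ v.asIdeal →
      ∀ y : W.subgroupH1 p κ.kerSubgroup,
        y ∈ unramifiedKer κ.kerSubgroup (W.geomPrimaryTorsion p) v →
          t • y ∈ awayKer κ.kerSubgroup (W.geomPrimaryTorsion p) v := by
  -- the finitely many bad places away from `p`
  set S : Set (HeightOneSpectrum (𝓞 K)) :=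
    {v | ¬ W.HasGoodReductionAt v ∧ ((p : ℕ) : 𝓞 K) ∉ v.asIdeal} with hS
  have hSfin : S.Finite := by
    refine (W.finite_badPlaces_holds (𝓞 K)).subset ?_
    rintro v ⟨hv, -⟩
    exact hv
  -- the local exponents
  let T : HeightOneSpectrum (𝓞 K) → ℕ := fun v ↦
    if h : ((p : ℕ) : 𝓞 K) ∉ v.asIdeal then
      Classical.choose (exists_nsmul_mem_awayKer_of_decomp_le W p h) else 1
  have hT : ∀ (v : HeightOneSpectrum (𝓞 K)) (h : ((p : ℕ) : 𝓞 K) ∉ v.asIdeal),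
      T v ≠ 0 ∧ ∀ (H : Subgroup (absoluteGaloisGroup K)), decomp v ≤ H →
        ∀ y : W.subgroupH1 p H, y ∈ unramifiedKer H (W.geomPrimaryTorsion p) v →
          T v • y ∈ awayKer H (W.geomPrimaryTorsion p) v := by
    intro v h
    have e : T v = Classical.choose (exists_nsmul_mem_awayKer_of_decomp_le W p h) := dif_pos h
    rw [e]
    exact Classical.choose_spec (exists_nsmul_mem_awayKer_of_decomp_le W p h)
  refine ⟨∏ v ∈ hSfin.toFinset, T v, ?_, fun v hpv y hy ↦ ?_⟩
  · rw [Finset.prod_ne_zero_iff]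
    intro v hv
    rw [Set.Finite.mem_toFinset] at hv
    exact (hT v hv.2).1
  · by_cases hD : decomp v ≤ κ.kerSubgroup
    · by_cases hgood : W.HasGoodReductionAt v
      · exact AddSubgroup.nsmul_mem _
          (mem_awayKer_of_mem_unramifiedKer_of_decomp_le W p hpv hgood hD hy) _
      · have hvS : v ∈ hSfin.toFinset := by
          rw [Set.Finite.mem_toFinset]
          exact ⟨hgood, hpv⟩
        obtain ⟨q, hq⟩ := Finset.dvd_prod_of_mem T hvS
        rw [hq, mul_comm, mul_smul]
        exact AddSubgroup.nsmul_mem _ ((hT v hpv).2 _ hD y hy) q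
    · have hI : inertia v ≤ κ.kerSubgroup := by
        have e : inertia v = (adicCompletionPrime K v).inertia (absoluteGaloisGroup K) :=
          (inertia_adicCompletionPrime_eq_map_absInertia K v).symm
        rw [e]
        exact ZpExtension.inertia_le_kerSubgroup_holds K p κ hpv (adicCompletionPrime_mem_primesAbove K v)
      exact AddSubgroup.nsmul_mem _
        (UnramifiedLeAwayKer.unramifiedKer_le_awayKer_of_not_decomp_le κ
          (W.isOpen_stabilizer_geomPrimaryTorsion' p) (W.exists_pow_smul_geomPrimaryTorsion_eq_zero p)
          hI hD hy) _

/-- **`t · datumStrictSelmer (ker κ) E[p^∞] p (bdpData 𝔭) ∅ ⊆ Sel_𝔭(K_∞, E[p^∞])` for one integer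
`t ≠ 0`** — the Pontryagin dual of the one-variable discrepancy "unramified vs. trivial away from `p`,
nothing vs. trivial at `∞`" between Greenberg–Vatsal's strict group and Castella's `Sel_𝔭(K_∞, E[p^∞])`
(`Σ = ∅`) is killed by `t`, for `K` with all infinite places complex and `𝔭 ∋ p` (the strict conditions
above `p` coincide, `selmerOver_empty_eq_strictSelmerGroupOver`). [cite: Castella2018, Def. 2.2 and §2.2 (arXiv:1704.06608 pp. 5, 7)]
[cite: GreenbergVatsal2000, §2 pp. 15–17] -/
theorem exists_nsmul_mem_selmerAc_of_mem_datumStrictSelmer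
    (hK : ∀ w : InfinitePlace K, w.IsComplex)
    {𝔭 : HeightOneSpectrum (𝓞 K)} (h𝔭 : ((p : ℕ) : 𝓞 K) ∈ 𝔭.asIdeal) :
    ∃ t : ℕ, t ≠ 0 ∧ ∀ a ∈ datumStrictSelmer κ.kerSubgroup (W.geomPrimaryTorsion p) p
        (AcSelmer.bdpData (W.geomPrimaryTorsion p) p 𝔭) ∅,
      t • a ∈ AcSelmer.selmerAc W p κ 𝔭 ∅ := by
  obtain ⟨t, ht0, ht⟩ := exists_nsmul_mem_awayKer_of_mem_unramifiedKer W p κ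
  refine ⟨t, ht0, fun a ha ↦ ?_⟩
  obtain ⟨hunr, hstr⟩ := (mem_datumStrictSelmer_iff a).1 ha
  rw [mem_unramifiedOutside_iff] at hunr
  rw [AcSelmer.selmerAc, AcSelmer.selmerOver_empty_eq_strictSelmerGroupOver p h𝔭,
    mem_strictSelmerGroupOver_iff]
  refine ⟨fun v hpv σ ↦ ?_, fun w σ ↦ ?_, fun v hv σ ↦ ?_⟩
  · rw [map_nsmul]
    exact ht v hpv _ (hunr v (Set.notMem_empty v) hpv σ)
  · exact mem_infKer_of_decompInf_eq_bot' W p w (BigGaloisRep.decompInf_eq_bot_of_isComplex (hK w)) _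
  · rw [map_nsmul]
    exact AddSubgroup.nsmul_mem _ (hstr v hv σ) t

end OneVariable

/-! ## §2 The registered stub (telescope binders of skeleton bdpline v15 / v17, verbatim) -/

/-- **Stub (b₁) `stub_awayDiscrepancySS` of line `bdpline`, PROVED** (registered signature, skeleton
bdpline v15 sha16 b1a347aa59181dce): for every character `x` of `H¹_{nr,v̄}(K̃_∞, E[p^∞])` vanishing on
`res(Sel_v̄(K_∞⁻, E[p^∞]))` there is `g ≠ 0` in `Λ = ℤ_p⟦T₂⟧` with `(C g · x)(res a) = 0` for every `a`
over `K_∞⁻` unramified away from `p` and strict at `v̄`. Take `g = t` the CONSTANT of §1 (for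
`E_K = W.baseChange K`, `κ = κ₂`, `𝔭 = v̄`; `K` imaginary quadratic has only complex places): `C t = t` in
`Λ₂`, `(t · x)(res a) = x(res (t · a))` and `t · a ∈ Sel_v̄(K_∞⁻, E[p^∞])`, where `x` vanishes. The other
telescope binders are idle. [cite: Castella2018, §2.2 (arXiv:1704.06608 p. 7)]
[cite: SkinnerUrban2014, Prop. 3.2.8 (p. 23)] -/
theorem stub_awayDiscrepancySS :
    SignedTwoVariableInputs → Literature.NumberTheory.EllipticCurves.ModularForms.nonempty_modularParametrizationData → ∀ (W : WeierstrassCurve ℚ) [W.IsElliptic] [W.IsGloballyMinimal] (p : ℕ) [Fact p.Prime], 5 ≤ p → W.HasGoodReductionAtPrime p → W.frobeniusTrace p = 0 → Literature.NumberTheory.EllipticCurves.Rank1Residual.Surj W p → ∀ (K : Type) [Field K] [NumberField K] (ι : PadicAlgCl p ≃+* ℂ) (v vbar : IsDedekindDomain.HeightOneSpectrum (NumberField.RingOfIntegers K)) (κ₁ κ₂ : Literature.NumberTheory.EllipticCurves.ZpExtension K p) (γ₁ γ₂ : Field.absoluteGaloisGroup K) [Fact (Literature.NumberTheory.EllipticCurves.ZpExtension.IsTopGeneratorPair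 κ₁ κ₂ γ₁ γ₂)] [NeZero (NumberField.discr K).natAbs] (N : ℕ) [NeZero N] (f : CuspForm (CongruenceSubgroup.Gamma0 N) 2), Literature.NumberTheory.EllipticCurves.ModularForms.IsNewformOf W f → (N : ℤ) = W.conductorNorm ℤ → Literature.NumberTheory.EllipticCurves.IsImaginaryQuadratic K → ((Ideal.span {(p : ℤ)}).primesOver (NumberField.RingOfIntegers K)).ncard = 2 → ((p : ℕ) : NumberField.RingOfIntegers K) ∈ v.asIdeal → ((p : ℕ) : NumberField.RingOfIntegers K) ∈ vbar.asIdeal → vbar ≠ v → (∀ (w : NumberField.InfinitePlace K) (k : NumberField.RingOfIntegers K), k ∈ v.asIdeal ↔ ‖ι.symm (w.embedding (k : K))‖ < 1) → IsCoprime (N : ℤ) (NumberField.discr K) → (∀ ℓ : ℕ, ℓ.Prime → ℓ ∣ N → ((Ideal.span {(ℓ : ℤ)}).primesOver (NumberField.RingOfIntegers K)).ncard = 2) → Odd (NumberField.discr K) → NumberField.discr K ≠ -3 → ∀ (hκ₁ : κ₁.IsCyclotomic), κ₂.IsAnticyclotomic → ∀ (hV : ∀ m : (W.baseChange K).geomPrimaryTorsion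 p, (∀ t ∈ Literature.NumberTheory.EllipticCurves.ZpExtension.pairKer κ₁ κ₂ ⊓ Literature.NumberTheory.EllipticCurves.GreenbergSelmer.inertia vbar, t • m = m) → m = 0) (hvbar' : ((p : ℕ) : NumberField.RingOfIntegers K) ∈ vbar.asIdeal) (x : (W.baseChange K).XGr₂ p κ₁ κ₂ vbar γ₁ γ₂), (∀ s : Literature.NumberTheory.EllipticCurves.Castella2018.AcSelmer.selmerAc (W.baseChange K) p κ₂ vbar ∅, x ((W.baseChange K).selmerAcToUnrSelmer₂ p κ₁ κ₂ vbar s) = 0) → ∃ g : Literature.NumberTheory.EllipticCurves.IwasawaAlgebra p, g ≠ 0 ∧ ∀ (a : (W.baseChange K).subgroupH1 p κ₂.kerSubgroup) (ha : a ∈ Literature.NumberTheory.EllipticCurves.GreenbergVatsal2000.datumStrictSelmer κ₂.kerSubgroup ((W.baseChange K).geomPrimaryTorsion p) p (Literature.NumberTheory.EllipticCurves.Castella2018.AcSelmer.bdpData ((W.baseChange K).geomPrimaryTorsion p) p vbar) ∅), ((PowerSeries.C g : Literature.NumberTheory.EllipticCurves.IwasawaAlgebra₂ p) • x) ⟨_,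 Summit.BirchSwinnertonDyer.BirchSwinnertonDyer.Theorems.SignedBaseChangeAcDivControlTorsion.resOfLe_mem_unrSelmer₂_of_mem_datumStrictSelmer (W.baseChange K) p κ₁ κ₂ vbar hκ₁ hvbar' hV ha⟩ = 0 := by
  intro _ _ W _ _ p _ _ _ _ _ K _ _ ι v vbar κ₁ κ₂ γ₁ γ₂ _ _ N _ f _ _ hK _ _ _ _ _ _ _ _ _ hκ₁ _ hV
    hvbar' x hx
  haveI : (W.baseChange K).IsElliptic := by rw [WeierstrassCurve.baseChange]; infer_instance
  have hcx : ∀ w : InfinitePlace K, w.IsComplex := fun w ↦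
    (IsImaginaryQuadratic.isTotallyComplex hK).isComplex w
  obtain ⟨t, ht0, ht⟩ :=
    exists_nsmul_mem_selmerAc_of_mem_datumStrictSelmer (W.baseChange K) p κ₂ hcx hvbar'
  refine ⟨(t : IwasawaAlgebra p), fun h ↦ ht0 ?_, fun a ha ↦ ?_⟩
  · -- `(t : ℤ_p⟦T⟧) = 0 ⟹ t = 0` (constant coefficient)
    have h1 := congrArg (PowerSeries.constantCoeff (R := ℤ_[p])) h
    rw [map_natCast, map_zero] at h1
    exact_mod_cast h1
  · -- `C t = t` acts as the integer `t`
    have e1 : (PowerSeries.C (t : IwasawaAlgebra p) : IwasawaAlgebra₂ p) = (t : IwasawaAlgebra₂ p) :=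
      map_natCast _ t
    rw [e1, Nat.cast_smul_eq_nsmul]
    -- `(t · x)(s) = x(t · s)` and `t · res a = res (t · a) = selmerAcToUnrSelmer₂ ⟨t · a, _⟩`
    set s : unrSelmer₂ κ₁ κ₂ ((W.baseChange K).geomPrimaryTorsion p) vbar :=
      ⟨_, SignedBaseChangeAcDivControlTorsion.resOfLe_mem_unrSelmer₂_of_mem_datumStrictSelmer
        (W.baseChange K) p κ₁ κ₂ vbar hκ₁ hvbar' hV ha⟩ with hs
    have e2 : (t • x) s =
        (show unrSelmer₂ κ₁ κ₂ ((W.baseChange K).geomPrimaryTorsion p) vbar →+ AddCircle (1 : ℚ)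
          from x) (t • s) := by
      rw [map_nsmul]
      rfl
    have e3 : t • s = (W.baseChange K).selmerAcToUnrSelmer₂ p κ₁ κ₂ vbar ⟨t • a, ht a ha⟩ := by
      apply Subtype.ext
      rw [WeierstrassCurve.coe_selmerAcToUnrSelmer₂_apply, AddSubgroup.coe_mk, map_nsmul]
      rfl
    rw [e2, e3]
    exact hx ⟨t • a, ht a ha⟩

end Summit.BirchSwinnertonDyer.BirchSwinnertonDyer.Theorems.SignedBaseChangeAcDivAwayDiscrepancy

end
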